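import Summits.Ventures.CertifiedManyBodySolver.Downfold.EmeryOrbitalWeightAxis
import HarnessLib

/-!
# THE SPREAD OF Cu-d CHARACTER OVER A σ FERMI SURFACE, EXACTLY: `w_axis(ε) − w_node(ε) = t_pd²(Δ + ε)ε²(t_pp + t_pp′)/[(t_pd²(Δ + 2ε) − t_pp′ε²)·(2t_pd²(Δ + 2ε) + (t_pp − t_pp′)ε²)]`
# — the k-dependence that a k-INDEPENDENT one-band (Zhang–Rice / antibonding-Wannier) weight drops, in closed form, for every charge-transfer parameter set

Venture CertifiedManyBodySolver, cell `pub/hubbard-downfold` (stage S1; INFLATION-RULES-3to1-B §B.72/§B.73 — the weight leg of the 3 → 1 reduction; this file = §B.73 (h): the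
FORM-FACTOR ERROR of the one-band image as one number per `(σ set, ε_F)`), seat hubbard-downfold-mod-4 (technique B, g29); namespace
`Summit.Ventures.CertifiedManyBodySolver.Downfold.Emery`. Sequel of `EmeryOrbitalWeightNode` (`dWeightNode_eq`), `EmeryOrbitalWeightAxis` (`dWeightAxis_eq`, the universal window
`dWeight_mem_Icc_node_axis`). Everything PROVED (0 sorry; two closed forms subtracted). WHAT THIS IS NOT: a statement about any material; `U = 0` one-body kinematics; the bound is
for the universal window `[w_node, w_axis]` — on a hole-like surface the attained spread `w_face − w_node` is smaller (census: 0.04–0.06 on the (K) rows vs the universal 0.07–0.08).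

* `dWeightAxis_sub_dWeightNode`: the exact identity above (`Δ + ε > 0`, `ε > 0`, `0 ≤ t_pp′ ≤ t_pp`, `t_pp′ε < t_pd²`, `t_pd ≠ 0`).
* **`dWeight_spread_le`**: for ANY two zone points `k, k′` of the same σ contour, `|w_d(k) − w_d(k′)| ≤ t_pd²(Δ + ε)ε²(t_pp + t_pp′)/(D_axis·D_node)` — the Cu-d character of the
  antibonding Bloch state varies over a whole Fermi surface by at most this closed-form amount (`→ 0` as `ε → 0` like `ε²`, and as `t_pp, t_pp′ → 0`: at the band bottom or without
  oxygen–oxygen hopping the weight is k-independent); `dWeightNode_le_dWeightAxis`; `dWeight_window_width_le_simple`: the cruder, monotone-readable bound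
  `w_axis − w_node ≤ (t_pp + t_pp′)·ε²·(Δ + ε)/(2·(t_pd²(Δ + 2ε) − t_pp′ε²)·(Δ + 2ε))` (e.g. La₂CuO₄ (K) at x = 0: ≈ 0.08; the attained hole-like spread is 0.054 by census).

Sources: three-band model [HybertsenSchluterChristensen1989, Eq. (1)]; [AndersenEtAl1995, §6]; Zhang–Rice one-band image [folklore]; [folklore] algebra.
-/

noncomputable section

namespace Summit.Ventures.CertifiedManyBodySolver.Downfold.Emery

open Real Set

/-- **THE WIDTH OF THE UNIVERSAL WEIGHT WINDOW IN CLOSED FORM**: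
`w_axis(ε) − w_node(ε) = t_pd²(Δ + ε)ε²(t_pp + t_pp′)/[(t_pd²(Δ + 2ε) − t_pp′ε²)(2t_pd²(Δ + 2ε) + (t_pp − t_pp′)ε²)]`. [folklore] -/
theorem dWeightAxis_sub_dWeightNode {Δ tpd tpp c ε : ℝ} (hE : 0 < Δ + ε) (hε : 0 < ε) (hc : 0 ≤ c) (hct : c ≤ tpp) (htpd : tpd ≠ 0) (hm : c * ε < tpd ^ 2)
    (hΔ : 0 ≤ Δ) :
    dWeightAxis Δ tpd tpp c ε - dWeightNode Δ tpd tpp c ε =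
      tpd ^ 2 * (Δ + ε) * ε ^ 2 * (tpp + c) / ((tpd ^ 2 * (Δ + 2 * ε) - c * ε ^ 2) * (2 * tpd ^ 2 * (Δ + 2 * ε) + (tpp - c) * ε ^ 2)) := by
  rw [dWeightAxis_eq hE hε htpd hm, dWeightNode_eq hΔ hc hct hε htpd]
  have ht : 0 < tpd ^ 2 := by positivity
  have hD1 : 0 < tpd ^ 2 * (Δ + 2 * ε) - c * ε ^ 2 := by nlinarith [mul_pos hε (sub_pos.2 hm), mul_pos ht hE]
  have hD2 : 0 < 2 * tpd ^ 2 * (Δ + 2 * ε) + (tpp - c) * ε ^ 2 := by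
    have : 0 ≤ (tpp - c) * ε ^ 2 := mul_nonneg (sub_nonneg.2 hct) (sq_nonneg ε)
    nlinarith [mul_pos ht hE]
  rw [div_sub_div _ _ hD1.ne' hD2.ne', div_eq_div_iff (mul_ne_zero hD1.ne' hD2.ne') (mul_ne_zero hD1.ne' hD2.ne')]
  ring

/-- The width is non-negative: `w_node(ε) ≤ w_axis(ε)` (regime as above). [folklore] -/
theorem dWeightNode_le_dWeightAxis {Δ tpd tpp c ε : ℝ} (hE : 0 < Δ + ε) (hε : 0 < ε) (hc : 0 ≤ c) (hct : c ≤ tpp) (htpd : tpd ≠ 0) (hm : c * ε < tpd ^ 2)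
    (hΔ : 0 ≤ Δ) : dWeightNode Δ tpd tpp c ε ≤ dWeightAxis Δ tpd tpp c ε := by
  have h := dWeightAxis_sub_dWeightNode hE hε hc hct htpd hm hΔ
  have ht : 0 < tpd ^ 2 := by positivity
  have hD1 : 0 < tpd ^ 2 * (Δ + 2 * ε) - c * ε ^ 2 := by nlinarith [mul_pos hε (sub_pos.2 hm), mul_pos ht hE]
  have hD2 : 0 < 2 * tpd ^ 2 * (Δ + 2 * ε) + (tpp - c) * ε ^ 2 := by
    have : 0 ≤ (tpp - c) * ε ^ 2 := mul_nonneg (sub_nonneg.2 hct) (sq_nonneg ε)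
    nlinarith [mul_pos ht hE]
  have htpp : 0 ≤ tpp + c := by linarith
  have : 0 ≤ tpd ^ 2 * (Δ + ε) * ε ^ 2 * (tpp + c) / ((tpd ^ 2 * (Δ + 2 * ε) - c * ε ^ 2) * (2 * tpd ^ 2 * (Δ + 2 * ε) + (tpp - c) * ε ^ 2)) := by
    positivity
  linarith

/-- **THE SPREAD OF Cu-d CHARACTER OVER ONE FERMI SURFACE IS AT MOST THE WINDOW WIDTH**: any two zone points `(x, y)`, `(x′, y′)` of the same `ε`-contour (regime `Δ ≥ 0`,
`0 ≤ t_pp′ ≤ t_pp`, `t_pp > 0`, `t_pd ≠ 0`, `ε > 0`, `t_pp′ε < t_pd²`) satisfy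
`|w_d(x, y; ε) − w_d(x′, y′; ε)| ≤ t_pd²(Δ + ε)ε²(t_pp + t_pp′)/[(t_pd²(Δ + 2ε) − t_pp′ε²)(2t_pd²(Δ + 2ε) + (t_pp − t_pp′)ε²)]`. [folklore] -/
theorem dWeight_spread_le {Δ tpd tpp c x y x' y' ε : ℝ} (hΔ : 0 ≤ Δ) (hc : 0 ≤ c) (hct : c ≤ tpp) (htpp : 0 < tpp) (htpd : tpd ≠ 0) (hε : 0 < ε)
    (hm : c * ε < tpd ^ 2) (hx : x ∈ Set.Icc (0 : ℝ) 1) (hy : y ∈ Set.Icc (0 : ℝ) 1) (hP : charCubic Δ tpd tpp c x y ε = 0)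
    (hx' : x' ∈ Set.Icc (0 : ℝ) 1) (hy' : y' ∈ Set.Icc (0 : ℝ) 1) (hP' : charCubic Δ tpd tpp c x' y' ε = 0) :
    |dWeight Δ tpd tpp c x y ε - dWeight Δ tpd tpp c x' y' ε| ≤
      tpd ^ 2 * (Δ + ε) * ε ^ 2 * (tpp + c) / ((tpd ^ 2 * (Δ + 2 * ε) - c * ε ^ 2) * (2 * tpd ^ 2 * (Δ + 2 * ε) + (tpp - c) * ε ^ 2)) := by
  have hE : 0 < Δ + ε := by linarith
  obtain ⟨-, h1⟩ := dWeight_mem_Icc_node_axis hΔ hc hct htpp htpd hε hm hx hy hP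
  obtain ⟨-, h2⟩ := dWeight_mem_Icc_node_axis hΔ hc hct htpp htpd hε hm hx' hy' hP'
  rw [← dWeightAxis_sub_dWeightNode hE hε hc hct htpd hm hΔ]
  rw [abs_le]
  constructor <;> linarith [h1.1, h1.2, h2.1, h2.2]

/-- A cruder, monotone-readable bound: the spread is at most `(t_pp + t_pp′)·ε²·(Δ + ε)/(2·(t_pd²(Δ + 2ε) − t_pp′ε²)·(Δ + 2ε))` (drop the `(t_pp − t_pp′)ε²` term of the second
denominator factor). [folklore] -/
theorem dWeight_window_width_le_simple {Δ tpd tpp c ε : ℝ} (hE : 0 < Δ + ε) (hε : 0 < ε) (hc : 0 ≤ c) (hct : c ≤ tpp) (htpd : tpd ≠ 0) (hm : c * ε < tpd ^ 2)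
    (hΔ : 0 ≤ Δ) :
    dWeightAxis Δ tpd tpp c ε - dWeightNode Δ tpd tpp c ε ≤ (tpp + c) * ε ^ 2 * (Δ + ε) / (2 * (tpd ^ 2 * (Δ + 2 * ε) - c * ε ^ 2) * (Δ + 2 * ε)) := by
  rw [dWeightAxis_sub_dWeightNode hE hε hc hct htpd hm hΔ]
  have ht : 0 < tpd ^ 2 := by positivity
  have hD1 : 0 < tpd ^ 2 * (Δ + 2 * ε) - c * ε ^ 2 := by nlinarith [mul_pos hε (sub_pos.2 hm), mul_pos ht hE]
  have hge : 2 * tpd ^ 2 * (Δ + 2 * ε) ≤ 2 * tpd ^ 2 * (Δ + 2 * ε) + (tpp - c) * ε ^ 2 := by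
    have : 0 ≤ (tpp - c) * ε ^ 2 := mul_nonneg (sub_nonneg.2 hct) (sq_nonneg ε)
    linarith
  have hD2' : 0 < 2 * tpd ^ 2 * (Δ + 2 * ε) := by have : 0 < Δ + 2 * ε := by linarith
                                                  positivity
  have htc : 0 ≤ tpp + c := by linarith
  -- compare the two fractions: same numerator structure up to the factor tpd², larger denominator on the left
  have hnum : 0 ≤ tpd ^ 2 * (Δ + ε) * ε ^ 2 * (tpp + c) := by positivity
  calc tpd ^ 2 * (Δ + ε) * ε ^ 2 * (tpp + c) / ((tpd ^ 2 * (Δ + 2 * ε) - c * ε ^ 2) * (2 * tpd ^ 2 * (Δ + 2 * ε) + (tpp - c) * ε ^ 2))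
      ≤ tpd ^ 2 * (Δ + ε) * ε ^ 2 * (tpp + c) / ((tpd ^ 2 * (Δ + 2 * ε) - c * ε ^ 2) * (2 * tpd ^ 2 * (Δ + 2 * ε))) := by
        apply div_le_div_of_nonneg_left hnum (mul_pos hD1 hD2') (mul_le_mul_of_nonneg_left hge hD1.le)
    _ = (tpp + c) * ε ^ 2 * (Δ + ε) / (2 * (tpd ^ 2 * (Δ + 2 * ε) - c * ε ^ 2) * (Δ + 2 * ε)) := by
        rw [div_eq_div_iff (mul_pos hD1 hD2').ne' (by positivity)]
        ring

end Summit.Ventures.CertifiedManyBodySolver.Downfold.Emery
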